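import Summits.AtomisticToContinuum.HydrodynamicLimit.Theorems.StiffCollisionalRelaxationAprioriBoundsEntropyRange
import HarnessLib

/-!
# Exact isentropy of classical hard-sphere Euler solutions: the total entropy `∫ ρ s dx` is conserved
(line `fibre-deficit-transfer`, crux `AprioriBounds`, stmt-AtomisticToContinuum-14827)

Support file (`--supports stmt-AtomisticToContinuum-14827`) of the lead prover of the line.  The statics stub
`stub_tiltedExcess` of the skeleton (`Cruxes/AprioriBounds/Lines/fibre_deficit_transfer.lean`, r2) packages four facts; three are
thermodynamic-limit labour, the fourth is EXACT ISENTROPY of the classical solution — the only place where the pre-shock horizon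
`t < T` enters the line: along a classical solution `IsHardSphereEulerSolution σ T ρ u θ` in a chamber `ρσ³ < η₀` on which the excess
free energy `f_ex` is smooth, the total entropy `∫ ρ(s,x) s(s,x) dx`, `s = (3/2) log θ − log ρ − f_ex(ρσ³)`, does not depend on
`s ∈ [0, T)` (`integral_density_mul_entropy_eq`, registered sub-goal).  Proof: the landed balance law
`AdiabatCeiling.adiabat_balance` (`∂ₜ(ρ G(A)) + div(ρ G(A) u) = 0` for every smooth `G` of the cubed adiabat `A = e^{2s}`), with a
smooth `G` equal to `½ log` on the range of `A` (bounded below by `min A(0,·) > 0`, `AdiabatCeiling.adiabat_range`), integrated over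
the torus (`Torus.integral_partialDeriv_eq_zero_holds`, differentiation under the integral `IsSmoothSpaceTimeOn.hasDerivWithinAt_integral`,
`constant_of_has_deriv_right_zero`).
-/

noncomputable section

open MeasureTheory Filter Set Topology
open scoped ENNReal ContDiff

namespace Summit.AtomisticToContinuum.HydrodynamicLimit.Theorems.FibreDeficitTransfer

open Literature.MathematicalPhysics.KineticTheory Literature.Analysis.FluidPDE
open Literature.Analysis.FunctionSpaces
open AdiabatCeiling (adiabat_balance adiabat_range isSmoothSpaceTimeOn_adiabat)

/-- A smooth function on `ℝ` equal to `½ log` on `[m, ∞)` (`m > 0`): `½ log h` with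
`h(r) = m/2 + (r − m/2)·φ(r)`, `φ = smoothTransition((4r − m)/m)` (so `h ≥ m/4 > 0`, `h = id` on `[m/2, ∞)`). -/
theorem exists_smooth_halfLog {m : ℝ} (hm : 0 < m) :
    ∃ G : ℝ → ℝ, ContDiff ℝ ∞ G ∧ ∀ r, m ≤ r → G r = 1 / 2 * Real.log r := by
  set φ : ℝ → ℝ := fun r => Real.smoothTransition ((4 * r - m) / m) with hφ
  set h : ℝ → ℝ := fun r => m / 2 + (r - m / 2) * φ r with hh
  have hφc : ContDiff ℝ ∞ φ :=
    Real.smoothTransition.contDiff.comp ((contDiff_const.mul contDiff_id).sub contDiff_const |>.div_const m)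
  have hhc : ContDiff ℝ ∞ h := contDiff_const.add ((contDiff_id.sub contDiff_const).mul hφc)
  have hpos : ∀ r, 0 < h r := by
    intro r
    simp only [hh, hφ]
    by_cases h1 : r ≤ m / 4
    · rw [Real.smoothTransition.zero_of_nonpos (by rw [div_nonpos_iff]; right; constructor <;> linarith), mul_zero,
        add_zero]
      positivity
    by_cases h2 : m / 2 ≤ r
    · rw [Real.smoothTransition.one_of_one_le (by rw [le_div_iff₀ hm]; linarith), mul_one]
      linarith
    · push Not at h1 h2
      have hφ0 := Real.smoothTransition.nonneg ((4 * r - m) / m)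
      have hφ1 := Real.smoothTransition.le_one ((4 * r - m) / m)
      nlinarith
  refine ⟨fun r => 1 / 2 * Real.log (h r), contDiff_const.mul (hhc.log fun r => (hpos r).ne'), fun r hr => ?_⟩
  simp only [hh, hφ]
  rw [Real.smoothTransition.one_of_one_le (by rw [le_div_iff₀ hm]; linarith), mul_one]
  congr 1
  congr 1
  ring

/-- `½ log` of the cubed adiabat is the specific entropy: `½ log (θ³/(ρ² e^{2f})) = (3/2) log θ − log ρ − f`. -/
theorem half_log_adiabat {θ₁ ρ₁ f : ℝ} (hθ : 0 < θ₁) (hρ : 0 < ρ₁) :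
    1 / 2 * Real.log (θ₁ ^ 3 / (ρ₁ ^ 2 * Real.exp (2 * f))) = 3 / 2 * Real.log θ₁ - Real.log ρ₁ - f := by
  rw [Real.log_div (by positivity) (by positivity), Real.log_mul (by positivity) (Real.exp_pos _).ne', Real.log_exp,
    Real.log_pow, Real.log_pow]
  push_cast
  ring

/-- **Exact isentropy of classical hard-sphere Euler solutions** (registered sub-goal `integral_density_mul_entropy_eq`): along a
classical solution in a chamber where `f_ex` is smooth, the total entropy `∫ ρ ((3/2) log θ − log ρ − f_ex(ρσ³)) dx` is the same at
every time `s ∈ [0, T)` as at time `0`. -/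
theorem integral_density_mul_entropy_eq : ∀ (σ T η₀ : ℝ) (ρ θ : ℝ → T3 → ℝ) (u : ℝ → T3 → V3), IsHardSphereEulerSolution σ T ρ u θ → 0 < σ → ContDiffOn ℝ ∞ hsExcessFreeEnergy (Ioo 0 η₀) → (∀ s ∈ Ico 0 T, ∀ x, ρ s x * σ ^ 3 < η₀) → ∀ s ∈ Ico 0 T, ∫ x, ρ s x * (3 / 2 * Real.log (θ s x) - Real.log (ρ s x) - hsExcessFreeEnergy (ρ s x * σ ^ 3)) = ∫ x, ρ 0 x * (3 / 2 * Real.log (θ 0 x) - Real.log (ρ 0 x) - hsExcessFreeEnergy (ρ 0 x * σ ^ 3)) := by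
  intro σ T η₀ ρ θ u hE hσ hF hch s hs
  have h0 : (0 : ℝ) ∈ Ico 0 T := ⟨le_rfl, hs.1.trans_lt hs.2⟩
  have hU : UniqueDiffOn ℝ (Ico (0 : ℝ) T) := uniqueDiffOn_Ico 0 T
  -- the cubed adiabat and its positive lower bound
  set A : ℝ → T3 → ℝ := fun s y => θ s y ^ 3 / (ρ s y ^ 2 * Real.exp (2 * hsExcessFreeEnergy (ρ s y * σ ^ 3))) with hA
  have hAs : Torus.IsSmoothSpaceTimeOn (Ico 0 T) A := isSmoothSpaceTimeOn_adiabat hE hσ hF hch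
  have hApos : ∀ s ∈ Ico 0 T, ∀ y, 0 < A s y := fun s hs y =>
    div_pos (pow_pos (hE.temperature_pos s hs y) 3) (mul_pos (pow_pos (hE.density_pos s hs y) 2) (Real.exp_pos _))
  have hc0 : Continuous (A 0) := (hAs.isSmooth_slice h0).continuous
  obtain ⟨y₀, -, hy₀⟩ := isCompact_univ.exists_isMinOn univ_nonempty hc0.continuousOn
  set m : ℝ := A 0 y₀ with hm
  have hmpos : 0 < m := hApos 0 h0 y₀
  have hAm : ∀ s ∈ Ico 0 T, ∀ x, m ≤ A s x := by
    intro s hs x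
    obtain ⟨⟨y, hy⟩, -⟩ := adiabat_range hE hσ hF hch hA hs x
    exact (isMinOn_iff.mp hy₀ y (mem_univ y)).trans hy
  -- a smooth `G = ½ log` on the range of `A`
  obtain ⟨G, hG, hGlog⟩ := exists_smooth_halfLog hmpos
  have hGA : ∀ s ∈ Ico 0 T, ∀ x, G (A s x) =
      3 / 2 * Real.log (θ s x) - Real.log (ρ s x) - hsExcessFreeEnergy (ρ s x * σ ^ 3) := by
    intro s hs x
    rw [hGlog _ (hAm s hs x)]
    exact half_log_adiabat (hE.temperature_pos s hs x) (hE.density_pos s hs x)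
  -- the entropy density `e = ρ G(A)` and its fluxes are smooth; the balance law is exact
  have hGAs : Torus.IsSmoothSpaceTimeOn (Ico 0 T) (fun s y => G (A s y)) := hG.comp_contDiffOn hAs
  have he : Torus.IsSmoothSpaceTimeOn (Ico 0 T) (fun s y => ρ s y * G (A s y)) := hE.smooth_density.mul hGAs
  have hΦ : ∀ i, Torus.IsSmoothSpaceTimeOn (Ico 0 T) (fun s y => ρ s y * G (A s y) * u s y i) :=
    fun i => he.mul (hE.smooth_velocity.apply i)
  have hbal : ∀ τ ∈ Ico 0 T, ∀ x, Torus.timeDerivWithin (Ico 0 T) (fun s y => ρ s y * G (A s y)) τ x +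
      ∑ i, Torus.partialDeriv i (fun y => ρ τ y * G (A τ y) * u τ y i) x = 0 :=
    fun τ hτ x => adiabat_balance hE hσ hF hch hG hA hτ x
  -- the total entropy and its vanishing one-sided derivative
  set E : ℝ → ℝ := fun τ => ∫ x, ρ τ x * G (A τ x) with hEdef
  have hderiv : ∀ τ ∈ Ico 0 T, HasDerivWithinAt E 0 (Ico 0 T) τ := by
    intro τ hτ
    have h1 : HasDerivWithinAt E (∫ x, Torus.timeDerivWithin (Ico 0 T) (fun s y => ρ s y * G (A s y)) τ x) (Ico 0 T) τ :=
      he.hasDerivWithinAt_integral (convex_Ico 0 T) hτ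
    have hflux : ∫ x, ∑ i, Torus.partialDeriv i (fun y => ρ τ y * G (A τ y) * u τ y i) x = 0 := by
      rw [integral_finsetSum _ fun i _ => (((hΦ i).isSmooth_slice hτ).partialDeriv i).integrable]
      exact Finset.sum_eq_zero fun i _ => Torus.integral_partialDeriv_eq_zero_holds ((hΦ i).isSmooth_slice hτ) i
    have hi1 : Integrable (Torus.timeDerivWithin (Ico 0 T) (fun s y => ρ s y * G (A s y)) τ) volume :=
      (he.isSmooth_timeDerivWithin hU hτ).integrable
    have hi2 : Integrable (fun x => ∑ i, Torus.partialDeriv i (fun y => ρ τ y * G (A τ y) * u τ y i) x) volume :=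
      integrable_finsetSum _ fun i _ => (((hΦ i).isSmooth_slice hτ).partialDeriv i).integrable
    have hzero : ∫ x, Torus.timeDerivWithin (Ico 0 T) (fun s y => ρ s y * G (A s y)) τ x = 0 := by
      calc ∫ x, Torus.timeDerivWithin (Ico 0 T) (fun s y => ρ s y * G (A s y)) τ x
          = ∫ x, (Torus.timeDerivWithin (Ico 0 T) (fun s y => ρ s y * G (A s y)) τ x +
              ∑ i, Torus.partialDeriv i (fun y => ρ τ y * G (A τ y) * u τ y i) x) := by
            rw [integral_add hi1 hi2, hflux, add_zero]
        _ = 0 := by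
            rw [integral_eq_zero_of_ae (Eventually.of_forall fun x => hbal τ hτ x)]
    rwa [hzero] at h1
  -- hence `E` is constant on `[0, s]`
  have hcont : ContinuousOn E (Icc 0 s) := fun τ hτ =>
    ((hderiv τ ⟨hτ.1, hτ.2.trans_lt hs.2⟩).continuousWithinAt).mono (Icc_subset_Ico_right hs.2)
  have hright : ∀ τ ∈ Ico 0 s, HasDerivWithinAt E 0 (Ici τ) τ := by
    intro τ hτ
    have hτT : τ ∈ Ico 0 T := ⟨hτ.1, hτ.2.trans hs.2⟩
    exact (hderiv τ hτT).mono_of_mem_nhdsWithin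
      (Filter.mem_of_superset (Ico_mem_nhdsGE hτT.2) (Ico_subset_Ico_left hτT.1))
  have hconst := constant_of_has_deriv_right_zero hcont hright s (right_mem_Icc.2 hs.1)
  -- read off the two total entropies
  have hEs : ∀ τ ∈ Ico 0 T, E τ = ∫ x, ρ τ x * (3 / 2 * Real.log (θ τ x) - Real.log (ρ τ x) -
      hsExcessFreeEnergy (ρ τ x * σ ^ 3)) := fun τ hτ =>
    integral_congr_ae (Eventually.of_forall fun x => by
      show ρ τ x * G (A τ x) = _
      rw [hGA τ hτ x])
  rw [← hEs s hs, ← hEs 0 h0]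
  exact hconst

end Summit.AtomisticToContinuum.HydrodynamicLimit.Theorems.FibreDeficitTransfer

end
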